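/-
  HodgeLocusCensusUnitColumnRankDrop.lean — pub-hlocus ENGINE B (ivhs-2, gen 56), PROBE 19 (successor material; probe-only until worded).
  certified instances and evidence bearing on the general Hodge conjecture; no claim.

  KERNEL RANK THEOREMS (evidence class; no census number changes; nothing about HC). THE SIZE OF THE DROP OF THE UNIT COLUMN OF ×q^c AT A PRIME p > c.
  For a prime p > c, a field K of characteristic p, a field K₀ of characteristic 0 and anchor 229's multiplicity matrix of ×q^c on K[x₁,…,x_k]/(xᵢ^{e+2})
  at level j (VERBATIM, as in anchors 230/294/296/298):
  (FY) `wilson_sum_add_eq` — THE PERIODIC FORM OF WILSON'S BLOCK RANK: for 2T ≤ m the Wilson sum of PROBE 16a/16b (anchor 293 `rank_smul_incl_eq`: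
      rank_K (c!·W_{T,T+c}(m)) = Σ_{i ≤ T} [p ∤ C(T+c−i, T−i)] (C(m,i) − C(m,i−1))) satisfies
          Σ_{i ≤ T} [p ∤ C(T+c−i, T−i)] (C(m,i) − C(m,i−1)) + Σ_{1 ≤ b ≤ (T+c)/p} C(m, T+c−bp) = C(m,T) + Σ_{1 ≤ b ≤ T/p} C(m, T−bp),
      i.e. rank_K = C(m,T) − C(m,T+c−p) + C(m,T−p) − C(m,T+c−2p) + C(m,T−2p) − ⋯ (KUMMER, anchor 296's `prime_dvd_choose_add_iff`: for p > c
      [p ∣ C(u+c, u)] = ⌊(u+c)/p⌋ − ⌊u/p⌋, and the floor-weighted telescoping sums collapse, `sum_div_mul_choose_tsub`); for (p, c) = (2, 1) this is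
      the alternating sum C(m,T) − C(m,T−1) + C(m,T−2) − ⋯ (cf. Linial–Rothschild 1981 for p = 2).
  (DROP) `rank_charP_add_eq_rank_charZero_add` — HEADLINE: rank_K + Σ_μ Σ_{1 ≤ b ≤ (T+c)/p} C(m, T+c−bp) = rank_{K₀} + Σ_μ Σ_{1 ≤ b ≤ T/p} C(m, T−bp),
      the outer sums over the feasible labels μ (e+1 ∣ j + Σμ, (e+1)s ≤ j + Σμ; s = #{μ ≠ 0}, t = (j + Σμ)/(e+1) − s, m = k − s) with a non-empty
      block (t + c ≤ m), T = min (t, m − t − c): PROBE 16b's double sum (anchor 294 `rank_mulDeltaPow_levels_eq_sum_wilson`) block by block in the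
      form (FY) (`blockval_add_eq`); rank_{K₀} is THEOREM L's value (anchor 229). Signed form `rank_charZero_sub_rank_charP_eq`:
          rank_{K₀} − rank_K = Σ_μ (Σ_{1 ≤ b ≤ (T+c)/p} C(m, T+c−bp) − Σ_{1 ≤ b ≤ T/p} C(m, T−bp)).
  (BDRY) `rank_charP_add_ite_eq_rank_charZero` — THE BOUNDARY PRIME: for 1 ≤ c < p and k + c = 2p (the least k with an exception at p, anchors
      296/298) rank_K + [j = (e+1)(p − c)] = rank_{K₀} at every level j, in every degree: the drop is exactly one, at exactly one level
      (`rank_charP_lt_rank_charZero_iff_of_boundary`; only the zero label carries a correction term, `corr_zero_eq_zero`, `corr_prime_eq_zero_of_ne`,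
      `corr_prime_zero_label`); the case c = p − 1 (k = p + 1, level e + 1) is PROBE 14 = anchor 278 `rank_mulDeltaPow_levels_first_exception`.
  14 theorems, 0 defs; imports PROBE 17 = anchor 296 `…HodgeLocusCensusUnitColumnRankLevelsCriterion` by name (hence 294, 293, 230, 229); nothing
  restated but anchor 229's matrix and anchor 294's feasibility / block conditions (VERBATIM); no sorries, axioms, instances or notation.
-/
import Summits.HodgeConjecture.HodgeConjecture.Theorems.HodgeLocusCensusUnitColumnRankLevelsCriterion

set_option linter.dupNamespace false
set_option autoImplicit false

namespace Summit.HodgeConjecture.HodgeConjecture.HodgeLocus.Census.UnitColumnRankDrop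

open Summit.HodgeConjecture.HodgeConjecture.HodgeLocus.Census.ModelNonJumpC1All (colR)
open Summit.HodgeConjecture.HodgeConjecture.HodgeLocus.Census.InclusionRankComplement (cast_factorial_ne_zero)
open Summit.HodgeConjecture.HodgeConjecture.HodgeLocus.Census.UnitColumnRankLevelsWilson (rank_mulDeltaPow_levels_eq_sum_wilson)
open Summit.HodgeConjecture.HodgeConjecture.HodgeLocus.Census.UnitColumnRankLevelsCriterion (prime_dvd_choose_add_iff choose_pred_lt_choose)

/-! ## §1 telescoping and floor-weighted sums over the increasing half of Pascal's row -/

/-- (T1) telescoping on the increasing half of Pascal's row: for `2n ≤ m`, `Σ_{i ≤ n} (C(m,i) − C(m,i−1)) = C(m,n)` (with `C(m,−1) = 0`;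
every summand is a genuine difference by anchor 296's `choose_pred_lt_choose`). -/
theorem sum_range_choose_tsub (m n : ℕ) (hn : 2 * n ≤ m) :
    (∑ i ∈ Finset.range (n + 1), (m.choose i - if i = 0 then 0 else m.choose (i - 1))) = m.choose n := by
  induction n with
  | zero => simp
  | succ n ih =>
    rw [Finset.sum_range_succ, ih (by omega)]
    have hlt := choose_pred_lt_choose m (n + 1) (by omega) hn
    rw [if_neg (Nat.succ_ne_zero n), Nat.add_sub_cancel]
    rw [Nat.add_sub_cancel] at hlt
    omega

/-- (T2) a head of the telescoping sum: for `n ≤ T` and `2n ≤ m`, `Σ_{i ≤ T, i ≤ n} (C(m,i) − C(m,i−1)) = C(m,n)`. -/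
theorem sum_range_ite_le_choose_tsub (m T n : ℕ) (hnT : n ≤ T) (hn : 2 * n ≤ m) :
    (∑ i ∈ Finset.range (T + 1), if i ≤ n then (m.choose i - if i = 0 then 0 else m.choose (i - 1)) else 0) =
      m.choose n := by
  rw [← Finset.sum_filter]
  have hf : (Finset.range (T + 1)).filter (fun i => i ≤ n) = Finset.range (n + 1) := by
    ext i
    simp only [Finset.mem_filter, Finset.mem_range]
    omega
  rw [hf, sum_range_choose_tsub m n hn]

/-- (F1) a floor as a count of multiples: for `0 < p` and `n ≤ N`, `⌊n/p⌋ = #{b < ⌊N/p⌋ : (b+1)p ≤ n}`. -/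
theorem div_eq_sum_range_ite (p n N : ℕ) (hp : 0 < p) (hnN : n ≤ N) :
    n / p = ∑ b ∈ Finset.range (N / p), if (b + 1) * p ≤ n then 1 else 0 := by
  rw [← Finset.sum_filter, Finset.sum_const, smul_eq_mul, mul_one]
  have hf : (Finset.range (N / p)).filter (fun b => (b + 1) * p ≤ n) = Finset.range (n / p) := by
    ext b
    simp only [Finset.mem_filter, Finset.mem_range]
    rw [← Nat.le_div_iff_mul_le hp]
    constructor
    · rintro ⟨_, h⟩
      omega
    · intro h
      exact ⟨lt_of_lt_of_le h (Nat.div_le_div_right hnN), by omega⟩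
  rw [hf, Finset.card_range]

/-- (G) THE FLOOR-WEIGHTED TELESCOPING SUM: for `0 < p`, `x ≤ p` and `2T ≤ m`,
`Σ_{i ≤ T} ⌊(T − i + x)/p⌋ · (C(m,i) − C(m,i−1)) = Σ_{1 ≤ b ≤ (T+x)/p} C(m, T + x − bp)` (swap the sums with (F1), then (T2)). -/
theorem sum_div_mul_choose_tsub (p x m T : ℕ) (hp : 0 < p) (hx : x ≤ p) (hT : 2 * T ≤ m) :
    (∑ i ∈ Finset.range (T + 1), (T - i + x) / p * (m.choose i - if i = 0 then 0 else m.choose (i - 1))) =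
      ∑ b ∈ Finset.range ((T + x) / p), m.choose (T + x - (b + 1) * p) := by
  have h1 : ∀ i ∈ Finset.range (T + 1),
      (T - i + x) / p * (m.choose i - if i = 0 then 0 else m.choose (i - 1)) =
        ∑ b ∈ Finset.range ((T + x) / p),
          if i ≤ T + x - (b + 1) * p then (m.choose i - if i = 0 then 0 else m.choose (i - 1)) else 0 := by
    intro i hi
    rw [Finset.mem_range] at hi
    rw [div_eq_sum_range_ite p (T - i + x) (T + x) hp (by omega), Finset.sum_mul]
    refine Finset.sum_congr rfl (fun b hb => ?_)
    rw [Finset.mem_range] at hb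
    have hb' : (b + 1) * p ≤ T + x := (Nat.le_div_iff_mul_le hp).mp (Nat.succ_le_of_lt hb)
    by_cases h : (b + 1) * p ≤ T - i + x
    · rw [if_pos h, if_pos (show i ≤ T + x - (b + 1) * p by omega), one_mul]
    · rw [if_neg h, if_neg (show ¬ (i ≤ T + x - (b + 1) * p) by omega), zero_mul]
  rw [Finset.sum_congr rfl h1, Finset.sum_comm]
  refine Finset.sum_congr rfl (fun b hb => ?_)
  rw [Finset.mem_range] at hb
  have hb' : (b + 1) * p ≤ T + x := (Nat.le_div_iff_mul_le hp).mp (Nat.succ_le_of_lt hb)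
  have hpx : x ≤ (b + 1) * p :=
    hx.trans (le_of_eq_of_le (one_mul p).symm (Nat.mul_le_mul_right p (Nat.succ_le_succ (Nat.zero_le b))))
  exact sum_range_ite_le_choose_tsub m T (T + x - (b + 1) * p) (by omega) (by omega)

/-! ## §2 THE PERIODIC FORM of Wilson's block rank `rank_K (c!·W_{T,T+c}(m))` for a prime `p > c` -/

/-- (W0) with the test `0 ∣ ·` (characteristic `0`) no term of the Wilson sum is dropped: the sum is `C(m,T)` (`2T ≤ m`; (T1)). -/
theorem wilson_sum_zero_eq (c m T N : ℕ) (hN : N = T + c) (hT : 2 * T ≤ m) :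
    (∑ i ∈ Finset.range (T + 1),
        if 0 ∣ (N - i).choose (T - i) then 0 else (m.choose i - if i = 0 then 0 else m.choose (i - 1))) = m.choose T := by
  subst hN
  rw [← sum_range_choose_tsub m T hT]
  refine Finset.sum_congr rfl (fun i hi => ?_)
  rw [Finset.mem_range] at hi
  rw [if_neg (show ¬ (0 ∣ (T + c - i).choose (T - i)) from fun h => (Nat.choose_pos (by omega)).ne' (zero_dvd_iff.mp h))]

/-- **(FY) THE PERIODIC FORM OF WILSON'S RANK FOR A PRIME `p > c`.** For `2T ≤ m`, the Wilson sum with the test `p ∣ C(T+c−i, T−i)` (the rank of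
`c!·W_{T,T+c}(m)` in characteristic `p`, anchor 293's `rank_smul_incl_eq`) satisfies
`Σ_{i ≤ T} [p ∤ C(T+c−i, T−i)] (C(m,i) − C(m,i−1)) + Σ_{1 ≤ b ≤ (T+c)/p} C(m, T+c−bp) = C(m,T) + Σ_{1 ≤ b ≤ T/p} C(m, T−bp)`, i.e.
`rank_K = C(m,T) − C(m,T+c−p) + C(m,T−p) − C(m,T+c−2p) + C(m,T−2p) − ⋯`: by Kummer (anchor 296's `prime_dvd_choose_add_iff`) the test fires at
`u = T − i` iff `⌊(u+c)/p⌋ = ⌊u/p⌋ + 1`, and both floor-weighted sums telescope by (G). For `(p, c) = (2, 1)` this is the alternating sum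
`C(m,T) − C(m,T−1) + C(m,T−2) − ⋯`. -/
theorem wilson_sum_add_eq {p c : ℕ} (hp : p.Prime) (hcp : c < p) (m T N : ℕ) (hN : N = T + c) (hT : 2 * T ≤ m) :
    (∑ i ∈ Finset.range (T + 1),
        if p ∣ (N - i).choose (T - i) then 0 else (m.choose i - if i = 0 then 0 else m.choose (i - 1))) +
      ∑ b ∈ Finset.range ((T + c) / p), m.choose (T + c - (b + 1) * p) =
    m.choose T + ∑ b ∈ Finset.range (T / p), m.choose (T - (b + 1) * p) := by
  subst hN
  have hG := sum_div_mul_choose_tsub p c m T hp.pos hcp.le hT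
  have hG0 := sum_div_mul_choose_tsub p 0 m T hp.pos (Nat.zero_le p) hT
  simp only [Nat.add_zero] at hG0
  rw [← hG, ← hG0, ← sum_range_choose_tsub m T hT, ← Finset.sum_add_distrib, ← Finset.sum_add_distrib]
  refine Finset.sum_congr rfl (fun i hi => ?_)
  rw [Finset.mem_range] at hi
  have hTi : T + c - i = T - i + c := by omega
  have hdiv : (T - i + c) / p = (T - i) / p + if p ≤ (T - i) % p + c then 1 else 0 := by
    rw [Nat.add_div hp.pos, Nat.div_eq_of_lt hcp, Nat.mod_eq_of_lt hcp, Nat.add_zero]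
  rw [hTi, hdiv]
  by_cases h : p ∣ (T - i + c).choose (T - i)
  · rw [if_pos h, if_pos ((prime_dvd_choose_add_iff hp hcp (T - i)).mp h)]
    ring
  · rw [if_neg h, if_neg (fun h' => h ((prime_dvd_choose_add_iff hp hcp (T - i)).mpr h'))]
    ring

/-! ## §3 PROBE 16b's block values (anchor 294) in characteristic `p` and `0`, with their correction sums -/

/-- (B+) per block of anchor 294's double sum: (the block value in characteristic `p`) + `Σ_{1 ≤ b ≤ (T+c)/p} C(m, T+c−bp)` = (the block value in
characteristic `0`) + `Σ_{1 ≤ b ≤ T/p} C(m, T−bp)`, where `T = min (t, m − t − c)`, for a prime `p > c`; for an empty block (`m < t + c`) all four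
terms are `0` ((W0), (FY) on the Wilson range `2t + c ≤ m` with `T = t` and on the complement range with `T = m − t − c`). -/
theorem blockval_add_eq {p c : ℕ} (hp : p.Prime) (hcp : c < p) (m t : ℕ) (P : Prop) [Decidable P] :
    (if P then
        (if m < t + c then 0
         else if t + (t + c) ≤ m then
           ∑ i ∈ Finset.range (t + 1),
             if p ∣ (t + c - i).choose (t - i) then 0 else (m.choose i - if i = 0 then 0 else m.choose (i - 1))
         else
           ∑ i ∈ Finset.range (m - (t + c) + 1),
             if p ∣ (m - t - i).choose (m - (t + c) - i) then 0 else (m.choose i - if i = 0 then 0 else m.choose (i - 1)))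
      else 0) +
      (if P then (if m < t + c then 0 else
        ∑ b ∈ Finset.range ((min t (m - t - c) + c) / p), m.choose (min t (m - t - c) + c - (b + 1) * p)) else 0) =
    (if P then
        (if m < t + c then 0
         else if t + (t + c) ≤ m then
           ∑ i ∈ Finset.range (t + 1),
             if 0 ∣ (t + c - i).choose (t - i) then 0 else (m.choose i - if i = 0 then 0 else m.choose (i - 1))
         else
           ∑ i ∈ Finset.range (m - (t + c) + 1),
             if 0 ∣ (m - t - i).choose (m - (t + c) - i) then 0 else (m.choose i - if i = 0 then 0 else m.choose (i - 1)))
      else 0) +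
      (if P then (if m < t + c then 0 else
        ∑ b ∈ Finset.range ((min t (m - t - c)) / p), m.choose (min t (m - t - c) - (b + 1) * p)) else 0) := by
  by_cases hP : P
  · simp only [if_pos hP]
    by_cases h1 : m < t + c
    · simp only [if_pos h1]
    · simp only [if_neg h1]
      by_cases h2 : t + (t + c) ≤ m
      · rw [if_pos h2, if_pos h2, Nat.min_eq_left (by omega), wilson_sum_zero_eq c m t (t + c) rfl (by omega)]
        exact wilson_sum_add_eq hp hcp m t (t + c) rfl (by omega)
      · rw [if_neg h2, if_neg h2, Nat.min_eq_right (by omega),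
          wilson_sum_zero_eq c m (m - (t + c)) (m - t) (by omega) (by omega),
          show m - t - c = m - (t + c) from Nat.sub_sub m t c]
        exact wilson_sum_add_eq hp hcp m (m - (t + c)) (m - t) (by omega) (by omega)
  · simp only [if_neg hP]

/-! ## §4 THE SIZE OF THE DROP for the census matrix of `×q^c` (anchor 229's multiplicity matrix, VERBATIM) -/

/-- **(DROP) THE CHARACTERISTIC-`p` RANK DEFICIT OF THE UNIT COLUMN OF `×q^c` IN CLOSED FORM.** For a prime `p > c`, a field `K` of
characteristic `p` and a field `K₀` of characteristic `0`: anchor 229's multiplicity matrix of `×q^c` on `K[x₁,…,x_k]/(xᵢ^{e+2})` at level `j`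
(VERBATIM) satisfies `rank_K + Σ_μ Σ_{1 ≤ b ≤ (T+c)/p} C(m, T+c−bp) = rank_{K₀} + Σ_μ Σ_{1 ≤ b ≤ T/p} C(m, T−bp)`, the outer sums running over
the feasible labels `μ` (`e+1 ∣ j + Σμ`, `(e+1)s ≤ j + Σμ`; `s = #{μ ≠ 0}`, `t = (j + Σμ)/(e+1) − s`, `m = k − s`) with a non-empty block
(`t + c ≤ m`), `T = min (t, m − t − c)`: PROBE 16b's double sum (anchor 294) with every block in the periodic form (FY), via (B+). `rank_{K₀}` is
THEOREM L's value (anchor 229's `rank_mulDeltaPow_levels`). -/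
theorem rank_charP_add_eq_rank_charZero_add (K K₀ : Type*) [Field K] [Field K₀] (p : ℕ) [CharP K p] [CharZero K₀] (hp : p.Prime)
    (k e c j : ℕ) (hcp : c < p) :
    (Matrix.of fun (v : {v : Fin k → Fin (e + 2) // (∑ i, (v i : ℕ)) + j = k * (e + 1)})
        (m : {m : Fin k → Fin (e + 2) // (∑ i, (m i : ℕ)) + (j + c * (e + 1)) = k * (e + 1)}) =>
      ((((List.flatMap (colR (e + 3)))^[c] [List.ofFn (fun i => (m.1 i : ℕ))]).count (List.ofFn (fun i => (v.1 i : ℕ))) : ℕ) : K)).rank +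
      ∑ μ : Fin k → Fin (e + 1),
        (if (e + 1) ∣ (j + ∑ i, (μ i : ℕ)) ∧ (e + 1) * (Finset.univ.filter (fun l => (μ l : ℕ) ≠ 0)).card ≤ j + ∑ i, (μ i : ℕ) then
          (if k - (Finset.univ.filter (fun l => (μ l : ℕ) ≠ 0)).card < ((j + ∑ i, (μ i : ℕ)) / (e + 1) - (Finset.univ.filter (fun l => (μ l : ℕ) ≠ 0)).card) + c then 0
           else ∑ b ∈ Finset.range ((min ((j + ∑ i, (μ i : ℕ)) / (e + 1) - (Finset.univ.filter (fun l => (μ l : ℕ) ≠ 0)).card)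
               (k - (Finset.univ.filter (fun l => (μ l : ℕ) ≠ 0)).card -
                 ((j + ∑ i, (μ i : ℕ)) / (e + 1) - (Finset.univ.filter (fun l => (μ l : ℕ) ≠ 0)).card) - c) + c) / p),
             (k - (Finset.univ.filter (fun l => (μ l : ℕ) ≠ 0)).card).choose (min ((j + ∑ i, (μ i : ℕ)) / (e + 1) - (Finset.univ.filter (fun l => (μ l : ℕ) ≠ 0)).card)
               (k - (Finset.univ.filter (fun l => (μ l : ℕ) ≠ 0)).card -
                 ((j + ∑ i, (μ i : ℕ)) / (e + 1) - (Finset.univ.filter (fun l => (μ l : ℕ) ≠ 0)).card) - c) + c - (b + 1) * p))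
         else 0) =
    (Matrix.of fun (v : {v : Fin k → Fin (e + 2) // (∑ i, (v i : ℕ)) + j = k * (e + 1)})
        (m : {m : Fin k → Fin (e + 2) // (∑ i, (m i : ℕ)) + (j + c * (e + 1)) = k * (e + 1)}) =>
      ((((List.flatMap (colR (e + 3)))^[c] [List.ofFn (fun i => (m.1 i : ℕ))]).count (List.ofFn (fun i => (v.1 i : ℕ))) : ℕ) : K₀)).rank +
      ∑ μ : Fin k → Fin (e + 1),
        (if (e + 1) ∣ (j + ∑ i, (μ i : ℕ)) ∧ (e + 1) * (Finset.univ.filter (fun l => (μ l : ℕ) ≠ 0)).card ≤ j + ∑ i, (μ i : ℕ) then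
          (if k - (Finset.univ.filter (fun l => (μ l : ℕ) ≠ 0)).card < ((j + ∑ i, (μ i : ℕ)) / (e + 1) - (Finset.univ.filter (fun l => (μ l : ℕ) ≠ 0)).card) + c then 0
           else ∑ b ∈ Finset.range ((min ((j + ∑ i, (μ i : ℕ)) / (e + 1) - (Finset.univ.filter (fun l => (μ l : ℕ) ≠ 0)).card)
               (k - (Finset.univ.filter (fun l => (μ l : ℕ) ≠ 0)).card -
                 ((j + ∑ i, (μ i : ℕ)) / (e + 1) - (Finset.univ.filter (fun l => (μ l : ℕ) ≠ 0)).card) - c)) / p),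
             (k - (Finset.univ.filter (fun l => (μ l : ℕ) ≠ 0)).card).choose (min ((j + ∑ i, (μ i : ℕ)) / (e + 1) - (Finset.univ.filter (fun l => (μ l : ℕ) ≠ 0)).card)
               (k - (Finset.univ.filter (fun l => (μ l : ℕ) ≠ 0)).card -
                 ((j + ∑ i, (μ i : ℕ)) / (e + 1) - (Finset.univ.filter (fun l => (μ l : ℕ) ≠ 0)).card) - c) - (b + 1) * p))
         else 0) := by
  rw [rank_mulDeltaPow_levels_eq_sum_wilson K p k e c j (cast_factorial_ne_zero K p hp c hcp),
    rank_mulDeltaPow_levels_eq_sum_wilson K₀ 0 k e c j (by exact_mod_cast Nat.factorial_ne_zero c),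
    ← Finset.sum_add_distrib, ← Finset.sum_add_distrib]
  exact Finset.sum_congr rfl (fun μ _ => blockval_add_eq hp hcp _ _ _)

/-- **(DROP′) THE SIZE OF THE DROP**, signed: `rank_{K₀} − rank_K = Σ_μ (Σ_{1 ≤ b ≤ (T+c)/p} C(m, T+c−bp) − Σ_{1 ≤ b ≤ T/p} C(m, T−bp))` in `ℤ`,
the sum over the feasible labels with a non-empty block (prime `p > c`; notation of (DROP)). -/
theorem rank_charZero_sub_rank_charP_eq (K K₀ : Type*) [Field K] [Field K₀] (p : ℕ) [CharP K p] [CharZero K₀] (hp : p.Prime)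
    (k e c j : ℕ) (hcp : c < p) :
    (((Matrix.of fun (v : {v : Fin k → Fin (e + 2) // (∑ i, (v i : ℕ)) + j = k * (e + 1)})
        (m : {m : Fin k → Fin (e + 2) // (∑ i, (m i : ℕ)) + (j + c * (e + 1)) = k * (e + 1)}) =>
      ((((List.flatMap (colR (e + 3)))^[c] [List.ofFn (fun i => (m.1 i : ℕ))]).count (List.ofFn (fun i => (v.1 i : ℕ))) : ℕ) : K₀)).rank : ℕ) : ℤ) -
      (((Matrix.of fun (v : {v : Fin k → Fin (e + 2) // (∑ i, (v i : ℕ)) + j = k * (e + 1)})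
        (m : {m : Fin k → Fin (e + 2) // (∑ i, (m i : ℕ)) + (j + c * (e + 1)) = k * (e + 1)}) =>
      ((((List.flatMap (colR (e + 3)))^[c] [List.ofFn (fun i => (m.1 i : ℕ))]).count (List.ofFn (fun i => (v.1 i : ℕ))) : ℕ) : K)).rank : ℕ) : ℤ) =
    ((∑ μ : Fin k → Fin (e + 1),
        (if (e + 1) ∣ (j + ∑ i, (μ i : ℕ)) ∧ (e + 1) * (Finset.univ.filter (fun l => (μ l : ℕ) ≠ 0)).card ≤ j + ∑ i, (μ i : ℕ) then
          (if k - (Finset.univ.filter (fun l => (μ l : ℕ) ≠ 0)).card < ((j + ∑ i, (μ i : ℕ)) / (e + 1) - (Finset.univ.filter (fun l => (μ l : ℕ) ≠ 0)).card) + c then 0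
           else ∑ b ∈ Finset.range ((min ((j + ∑ i, (μ i : ℕ)) / (e + 1) - (Finset.univ.filter (fun l => (μ l : ℕ) ≠ 0)).card)
               (k - (Finset.univ.filter (fun l => (μ l : ℕ) ≠ 0)).card -
                 ((j + ∑ i, (μ i : ℕ)) / (e + 1) - (Finset.univ.filter (fun l => (μ l : ℕ) ≠ 0)).card) - c) + c) / p),
             (k - (Finset.univ.filter (fun l => (μ l : ℕ) ≠ 0)).card).choose (min ((j + ∑ i, (μ i : ℕ)) / (e + 1) - (Finset.univ.filter (fun l => (μ l : ℕ) ≠ 0)).card)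
               (k - (Finset.univ.filter (fun l => (μ l : ℕ) ≠ 0)).card -
                 ((j + ∑ i, (μ i : ℕ)) / (e + 1) - (Finset.univ.filter (fun l => (μ l : ℕ) ≠ 0)).card) - c) + c - (b + 1) * p))
         else 0) : ℕ) : ℤ) -
      ((∑ μ : Fin k → Fin (e + 1),
        (if (e + 1) ∣ (j + ∑ i, (μ i : ℕ)) ∧ (e + 1) * (Finset.univ.filter (fun l => (μ l : ℕ) ≠ 0)).card ≤ j + ∑ i, (μ i : ℕ) then
          (if k - (Finset.univ.filter (fun l => (μ l : ℕ) ≠ 0)).card < ((j + ∑ i, (μ i : ℕ)) / (e + 1) - (Finset.univ.filter (fun l => (μ l : ℕ) ≠ 0)).card) + c then 0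
           else ∑ b ∈ Finset.range ((min ((j + ∑ i, (μ i : ℕ)) / (e + 1) - (Finset.univ.filter (fun l => (μ l : ℕ) ≠ 0)).card)
               (k - (Finset.univ.filter (fun l => (μ l : ℕ) ≠ 0)).card -
                 ((j + ∑ i, (μ i : ℕ)) / (e + 1) - (Finset.univ.filter (fun l => (μ l : ℕ) ≠ 0)).card) - c)) / p),
             (k - (Finset.univ.filter (fun l => (μ l : ℕ) ≠ 0)).card).choose (min ((j + ∑ i, (μ i : ℕ)) / (e + 1) - (Finset.univ.filter (fun l => (μ l : ℕ) ≠ 0)).card)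
               (k - (Finset.univ.filter (fun l => (μ l : ℕ) ≠ 0)).card -
                 ((j + ∑ i, (μ i : ℕ)) / (e + 1) - (Finset.univ.filter (fun l => (μ l : ℕ) ≠ 0)).card) - c) - (b + 1) * p))
         else 0) : ℕ) : ℤ) := by
  have h := rank_charP_add_eq_rank_charZero_add K K₀ p hp k e c j hcp
  omega

/-! ## §5 THE BOUNDARY PRIME `k + c = 2p`: a drop of exactly one at exactly one level (PROBE 14 = anchor 278 is the case `c = p − 1`) -/

/-- (Z0) for `0 < c` and `k + c ≤ 2p` no characteristic-`0` correction term survives: every non-empty feasible block has `T < p`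
(`2T + c ≤ m ≤ k`). -/
theorem corr_zero_eq_zero (p k e c j : ℕ) (hc : 0 < c) (hk : k + c ≤ 2 * p) (μ : Fin k → Fin (e + 1)) :
    (if (e + 1) ∣ (j + ∑ i, (μ i : ℕ)) ∧ (e + 1) * (Finset.univ.filter (fun l => (μ l : ℕ) ≠ 0)).card ≤ j + ∑ i, (μ i : ℕ) then
      (if k - (Finset.univ.filter (fun l => (μ l : ℕ) ≠ 0)).card < ((j + ∑ i, (μ i : ℕ)) / (e + 1) - (Finset.univ.filter (fun l => (μ l : ℕ) ≠ 0)).card) + c then 0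
       else ∑ b ∈ Finset.range ((min ((j + ∑ i, (μ i : ℕ)) / (e + 1) - (Finset.univ.filter (fun l => (μ l : ℕ) ≠ 0)).card)
           (k - (Finset.univ.filter (fun l => (μ l : ℕ) ≠ 0)).card -
             ((j + ∑ i, (μ i : ℕ)) / (e + 1) - (Finset.univ.filter (fun l => (μ l : ℕ) ≠ 0)).card) - c)) / p),
         (k - (Finset.univ.filter (fun l => (μ l : ℕ) ≠ 0)).card).choose (min ((j + ∑ i, (μ i : ℕ)) / (e + 1) - (Finset.univ.filter (fun l => (μ l : ℕ) ≠ 0)).card)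
           (k - (Finset.univ.filter (fun l => (μ l : ℕ) ≠ 0)).card -
             ((j + ∑ i, (μ i : ℕ)) / (e + 1) - (Finset.univ.filter (fun l => (μ l : ℕ) ≠ 0)).card) - c) - (b + 1) * p))
     else 0) = 0 := by
  have hs : (Finset.univ.filter (fun l => (μ l : ℕ) ≠ 0)).card ≤ k :=
    (Finset.card_filter_le _ _).trans_eq (by rw [Finset.card_univ, Fintype.card_fin])
  split_ifs with hF hlt
  · rfl
  · rw [Nat.div_eq_of_lt (by rw [Nat.min_def]; split_ifs <;> omega), Finset.range_zero, Finset.sum_empty]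
  · rfl

/-- (ZP) for `k + c ≤ 2p` a label with a NON-ZERO coordinate (`s ≥ 1`, so `m ≤ k − 1`) carries no characteristic-`p` correction term:
`T + c < p` (`2(T + c) ≤ m + c ≤ k + c − 1 < 2p`). -/
theorem corr_prime_eq_zero_of_ne (p k e c j : ℕ) (hk : k + c ≤ 2 * p) (μ : Fin k → Fin (e + 1)) (hμ : μ ≠ fun _ => 0) :
    (if (e + 1) ∣ (j + ∑ i, (μ i : ℕ)) ∧ (e + 1) * (Finset.univ.filter (fun l => (μ l : ℕ) ≠ 0)).card ≤ j + ∑ i, (μ i : ℕ) then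
      (if k - (Finset.univ.filter (fun l => (μ l : ℕ) ≠ 0)).card < ((j + ∑ i, (μ i : ℕ)) / (e + 1) - (Finset.univ.filter (fun l => (μ l : ℕ) ≠ 0)).card) + c then 0
       else ∑ b ∈ Finset.range ((min ((j + ∑ i, (μ i : ℕ)) / (e + 1) - (Finset.univ.filter (fun l => (μ l : ℕ) ≠ 0)).card)
           (k - (Finset.univ.filter (fun l => (μ l : ℕ) ≠ 0)).card -
             ((j + ∑ i, (μ i : ℕ)) / (e + 1) - (Finset.univ.filter (fun l => (μ l : ℕ) ≠ 0)).card) - c) + c) / p),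
         (k - (Finset.univ.filter (fun l => (μ l : ℕ) ≠ 0)).card).choose (min ((j + ∑ i, (μ i : ℕ)) / (e + 1) - (Finset.univ.filter (fun l => (μ l : ℕ) ≠ 0)).card)
           (k - (Finset.univ.filter (fun l => (μ l : ℕ) ≠ 0)).card -
             ((j + ∑ i, (μ i : ℕ)) / (e + 1) - (Finset.univ.filter (fun l => (μ l : ℕ) ≠ 0)).card) - c) + c - (b + 1) * p))
     else 0) = 0 := by
  have hs : (Finset.univ.filter (fun l => (μ l : ℕ) ≠ 0)).card ≤ k :=
    (Finset.card_filter_le _ _).trans_eq (by rw [Finset.card_univ, Fintype.card_fin])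
  obtain ⟨l, hl⟩ := Function.ne_iff.mp hμ
  have hs1 : 1 ≤ (Finset.univ.filter (fun l => (μ l : ℕ) ≠ 0)).card :=
    Finset.card_pos.mpr ⟨l, Finset.mem_filter.mpr ⟨Finset.mem_univ _, fun h => hl (Fin.ext h)⟩⟩
  split_ifs with hF hlt
  · rfl
  · rw [Nat.div_eq_of_lt (by rw [Nat.min_def]; split_ifs <;> omega), Finset.range_zero, Finset.sum_empty]
  · rfl

/-- (Z1) for `c < p` and `k + c = 2p` the ZERO label carries the characteristic-`p` correction term `[j = (e+1)(p − c)]` (its block is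
`c!·W_{p−c,p}` on all `k` coordinates: `t = p − c = m − t − c`, `T + c = p`, one surviving binomial `C(k, 0) = 1`). -/
theorem corr_prime_zero_label (p k e c j : ℕ) (hp : p.Prime) (hcp : c < p) (hk : k + c = 2 * p) :
    (fun (μ : Fin k → Fin (e + 1)) =>
      (if (e + 1) ∣ (j + ∑ i, (μ i : ℕ)) ∧ (e + 1) * (Finset.univ.filter (fun l => (μ l : ℕ) ≠ 0)).card ≤ j + ∑ i, (μ i : ℕ) then
        (if k - (Finset.univ.filter (fun l => (μ l : ℕ) ≠ 0)).card < ((j + ∑ i, (μ i : ℕ)) / (e + 1) - (Finset.univ.filter (fun l => (μ l : ℕ) ≠ 0)).card) + c then 0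
         else ∑ b ∈ Finset.range ((min ((j + ∑ i, (μ i : ℕ)) / (e + 1) - (Finset.univ.filter (fun l => (μ l : ℕ) ≠ 0)).card)
             (k - (Finset.univ.filter (fun l => (μ l : ℕ) ≠ 0)).card -
               ((j + ∑ i, (μ i : ℕ)) / (e + 1) - (Finset.univ.filter (fun l => (μ l : ℕ) ≠ 0)).card) - c) + c) / p),
           (k - (Finset.univ.filter (fun l => (μ l : ℕ) ≠ 0)).card).choose (min ((j + ∑ i, (μ i : ℕ)) / (e + 1) - (Finset.univ.filter (fun l => (μ l : ℕ) ≠ 0)).card)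
             (k - (Finset.univ.filter (fun l => (μ l : ℕ) ≠ 0)).card -
               ((j + ∑ i, (μ i : ℕ)) / (e + 1) - (Finset.univ.filter (fun l => (μ l : ℕ) ≠ 0)).card) - c) + c - (b + 1) * p))
       else 0)) (fun _ => 0) =
    if j = (e + 1) * (p - c) then 1 else 0 := by
  have hs : (Finset.univ.filter (fun l : Fin k => (((fun _ => (0 : Fin (e + 1))) l : Fin (e + 1)) : ℕ) ≠ 0)).card = 0 := by
    simp
  have hsum : (∑ i : Fin k, (((fun _ => (0 : Fin (e + 1))) i : Fin (e + 1)) : ℕ)) = 0 := by simp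
  simp only [hs, hsum, add_zero, mul_zero, Nat.sub_zero]
  by_cases hd : (e + 1) ∣ j
  · obtain ⟨t, rfl⟩ := hd
    rw [if_pos ⟨Dvd.intro _ rfl, Nat.zero_le _⟩, Nat.mul_div_cancel_left t (Nat.succ_pos e)]
    by_cases ht : t = p - c
    · subst ht
      rw [if_pos rfl, if_neg (by omega), show k - (p - c) - c = p - c by omega, Nat.min_self, Nat.sub_add_cancel hcp.le,
        Nat.div_self hp.pos, Finset.sum_range_one, show p - (0 + 1) * p = 0 by simp, Nat.choose_zero_right]
    · rw [if_neg (fun h => ht (Nat.eq_of_mul_eq_mul_left (Nat.succ_pos e) h))]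
      split_ifs with hlt
      · rfl
      · rw [Nat.div_eq_of_lt (by rw [Nat.min_def]; split_ifs <;> omega), Finset.range_zero, Finset.sum_empty]
  · rw [if_neg (fun h => hd h.1), if_neg (fun h => hd (by rw [h]; exact Dvd.intro _ rfl))]

/-- **(BDRY) THE BOUNDARY PRIME DROPS BY EXACTLY ONE AT EXACTLY ONE LEVEL.** For a prime `p` and `1 ≤ c < p`, on `k = 2p − c` variables (the
least `k` with an exception at `p`, anchors 296/298) the unit column of `×q^c` on `K[x₁,…,x_k]/(xᵢ^{e+2})` (anchor 229's matrix VERBATIM) has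
characteristic-`p` rank `rank_{K₀} − [j = (e+1)(p − c)]` at every level `j`, in every degree: `rank_K + [j = (e+1)(p − c)] = rank_{K₀}` ((DROP)
with (Z0), (ZP), (Z1)). The case `c = p − 1` (`k = p + 1`, level `e + 1`) is PROBE 14 = anchor 278 `rank_mulDeltaPow_levels_first_exception`. -/
theorem rank_charP_add_ite_eq_rank_charZero (K K₀ : Type*) [Field K] [Field K₀] (p : ℕ) [CharP K p] [CharZero K₀] (hp : p.Prime)
    (k e c j : ℕ) (hc : 0 < c) (hcp : c < p) (hk : k + c = 2 * p) :
    (Matrix.of fun (v : {v : Fin k → Fin (e + 2) // (∑ i, (v i : ℕ)) + j = k * (e + 1)})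
        (m : {m : Fin k → Fin (e + 2) // (∑ i, (m i : ℕ)) + (j + c * (e + 1)) = k * (e + 1)}) =>
      ((((List.flatMap (colR (e + 3)))^[c] [List.ofFn (fun i => (m.1 i : ℕ))]).count (List.ofFn (fun i => (v.1 i : ℕ))) : ℕ) : K)).rank +
      (if j = (e + 1) * (p - c) then 1 else 0) =
    (Matrix.of fun (v : {v : Fin k → Fin (e + 2) // (∑ i, (v i : ℕ)) + j = k * (e + 1)})
        (m : {m : Fin k → Fin (e + 2) // (∑ i, (m i : ℕ)) + (j + c * (e + 1)) = k * (e + 1)}) =>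
      ((((List.flatMap (colR (e + 3)))^[c] [List.ofFn (fun i => (m.1 i : ℕ))]).count (List.ofFn (fun i => (v.1 i : ℕ))) : ℕ) : K₀)).rank := by
  have h := rank_charP_add_eq_rank_charZero_add K K₀ p hp k e c j hcp
  rw [Finset.sum_eq_zero (fun μ _ => corr_zero_eq_zero p k e c j hc hk.le μ), add_zero,
    Finset.sum_eq_single (fun _ => (0 : Fin (e + 1))) (fun μ _ hμ => corr_prime_eq_zero_of_ne p k e c j hk.le μ hμ)
      (fun h' => absurd (Finset.mem_univ _) h')] at h
  have h0 := corr_prime_zero_label p k e c j hp hcp hk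
  simp only [] at h0
  rw [h0] at h
  exact h

/-- (BDRY′) for a prime `p`, `1 ≤ c < p` and `k + c = 2p`: the characteristic-`p` rank of the unit column of `×q^c` at level `j` is smaller
than the characteristic-`0` rank iff `j = (e+1)(p − c)` ((BDRY)). -/
theorem rank_charP_lt_rank_charZero_iff_of_boundary (K K₀ : Type*) [Field K] [Field K₀] (p : ℕ) [CharP K p] [CharZero K₀] (hp : p.Prime)
    (k e c j : ℕ) (hc : 0 < c) (hcp : c < p) (hk : k + c = 2 * p) :
    (Matrix.of fun (v : {v : Fin k → Fin (e + 2) // (∑ i, (v i : ℕ)) + j = k * (e + 1)})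
        (m : {m : Fin k → Fin (e + 2) // (∑ i, (m i : ℕ)) + (j + c * (e + 1)) = k * (e + 1)}) =>
      ((((List.flatMap (colR (e + 3)))^[c] [List.ofFn (fun i => (m.1 i : ℕ))]).count (List.ofFn (fun i => (v.1 i : ℕ))) : ℕ) : K)).rank <
    (Matrix.of fun (v : {v : Fin k → Fin (e + 2) // (∑ i, (v i : ℕ)) + j = k * (e + 1)})
        (m : {m : Fin k → Fin (e + 2) // (∑ i, (m i : ℕ)) + (j + c * (e + 1)) = k * (e + 1)}) =>
      ((((List.flatMap (colR (e + 3)))^[c] [List.ofFn (fun i => (m.1 i : ℕ))]).count (List.ofFn (fun i => (v.1 i : ℕ))) : ℕ) : K₀)).rank ↔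
    j = (e + 1) * (p - c) := by
  have h := rank_charP_add_ite_eq_rank_charZero K K₀ p hp k e c j hc hcp hk
  by_cases hj : j = (e + 1) * (p - c)
  · rw [if_pos hj] at h
    exact iff_of_true (by omega) hj
  · rw [if_neg hj] at h
    exact iff_of_false (by omega) hj

end Summit.HodgeConjecture.HodgeConjecture.HodgeLocus.Census.UnitColumnRankDrop
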